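import Literature.Analysis.Convex.SelfConcordantFunctions
import HarnessLib

/-!
# Self-concordant functions: integrated bounds, suboptimality and the damped Newton step

One-dimensional consequences of self-concordance obtained by integrating the Hessian bounds
(9.46) of [BV04, §9.6.3] (recorded in `SelfConcordantFunctions.lean` as
`SelfConcordantWith.deriv2_lower_bound` / `deriv2_upper_bound`), for a strictly convex
self-concordant `f` on an interval, with first/second/third derivative witnesses `f₁, f₂, f₃`
(`SelfConcordantWith s f f₁ f₂ f₃`):

* (9.47) `f'(t) ≥ f'(0) + f''(0)^{1/2} − f''(0)^{1/2} / (1 + t f''(0)^{1/2})` and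
  (9.48) `f(t) ≥ f(0) + t f'(0) + t f''(0)^{1/2} − log (1 + t f''(0)^{1/2})` for `t ≥ 0`
  (`deriv_lower_bound`, `lower_bound`); and the upper counterparts obtained "if we integrate the
  upper bound in (9.46) twice" [BV04, §9.6.4 (9.54)]:
  `f(t) ≤ f(0) + t f'(0) − t f''(0)^{1/2} − log (1 − t f''(0)^{1/2})` for `0 ≤ t f''(0)^{1/2} < 1`
  (`deriv_upper_bound`, `upper_bound`), stated to the right of the base point (the two-sided
  consequences below are obtained by the reflection `t ↦ −t`, an instance of
  `SelfConcordantWith.comp_affine`);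
* the Newton decrement in one variable, `λ(x) = |f'(x)| / f''(x)^{1/2}`
  ([BV04, §9.5.1]: `λ(x) = (∇f(x)ᵀ ∇²f(x)⁻¹ ∇f(x))^{1/2}`), and the bound on suboptimality
  [BV04, §9.6.3 (9.49)]: `f(y) ≥ f(x) + λ(x) + log (1 − λ(x))` for every `y` in the interval,
  provided `λ(x) < 1` (`newton_lower_bound`), hence (9.50) `f(y) ≥ f(x) − λ(x)²` when
  `λ(x) ≤ 0.68` (`sub_sq_le`) and the stopping criterion "`λ(x)² ≤ ε` guarantees
  `f(x) − p⋆ ≤ ε`" (`sub_le_of_sq_le`);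
* the two scalar inequalities BV use on the way — `−(λ + log(1 − λ)) ≤ λ²` for `0 ≤ λ ≤ 0.68`
  [BV04, p. 503] (`neg_add_log_one_sub_le_sq`, with the endpoint certified from the exponential
  series `∑_{i<6} 1.1424ⁱ/i! ≤ e^{1.1424}`) and `−x + log(1 + x) + x²/(2(1 + x)) ≤ 0` for `x ≥ 0`
  [BV04, p. 504] (`neg_add_log_add_sq_div_le`) — and the minimisation step behind (9.49),
  `(1 − λ) u − log (1 + u) ≥ λ + log (1 − λ)` for `u ≥ 0` (`add_log_le_sub_mul_sub_log`);
* the damped Newton step of [BV04, §9.6.4]: with the Newton step `Δ = −f'(x)/f''(x)` and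
  `t̂ = 1/(1 + λ(x))`, `f(x + t̂Δ) ≤ f(x) − λ(x) + log(1 + λ(x)) ≤ f(x) − λ(x)²/(2(1 + λ(x)))`
  (`damped_newton_step_le`), i.e. the point `t̂` "satisfies the exit condition of the line search"
  for every `α ≤ 1/2`.

Hypotheses throughout: the closed segment between the two points lies in `s` and `f'' > 0` on it
(BV's standing assumption "strictly convex self-concordant").
-/

open Real Set Filter
open scoped Topology

namespace Literature.Analysis.Convex.SelfConcordant

/-! ## Scalar inequalities -/

/-- The minimisation behind (9.49): for `0 ≤ λ < 1` and `u ≥ 0`,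
`λ + log (1 − λ) ≤ (1 − λ) u − log (1 + u)` (the right-hand side of (9.48), as a function of
`u = t f''(0)^{1/2}` with `λ = −f'(0) f''(0)^{-1/2}`, "reaches its minimum" `λ + log(1 − λ)` at
`u = λ/(1 − λ)`). [cite: BoydVandenberghe2004, §9.6.3 p. 502] -/
theorem add_log_le_sub_mul_sub_log {lam u : ℝ} (h1 : lam < 1) (hu : 0 ≤ u) :
    lam + Real.log (1 - lam) ≤ (1 - lam) * u - Real.log (1 + u) := by
  have hpos : 0 < (1 + u) * (1 - lam) := mul_pos (by linarith) (by linarith)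
  have hlog : Real.log ((1 + u) * (1 - lam)) ≤ (1 + u) * (1 - lam) - 1 :=
    Real.log_le_sub_one_of_pos hpos
  rw [Real.log_mul (by linarith) (by linarith)] at hlog
  nlinarith

/-- `λ + log (1 − λ) ≤ 0` for `λ < 1`. [cite: BoydVandenberghe2004, §9.6.3 p. 503] -/
theorem add_log_one_sub_nonpos {lam : ℝ} (h1 : lam < 1) : lam + Real.log (1 - lam) ≤ 0 := by
  have := Real.log_le_sub_one_of_pos (show 0 < 1 - lam by linarith)
  linarith

/-- A private monotonicity helper: a function with a nonnegative derivative on `[x, y]` does not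
decrease from `x` to `y`. [folklore] -/
private theorem le_of_hasDerivAt_nonneg {g g' : ℝ → ℝ} {x y : ℝ} (hxy : x ≤ y)
    (hg : ∀ t ∈ Icc x y, HasDerivAt g (g' t) t) (hpos : ∀ t ∈ Ioo x y, 0 ≤ g' t) :
    g x ≤ g y := by
  have hmono : MonotoneOn g (Icc x y) := by
    refine monotoneOn_of_deriv_nonneg (convex_Icc x y) ?_ ?_ ?_
    · exact fun t ht => (hg t ht).continuousAt.continuousWithinAt
    · exact fun t ht => (hg t (interior_subset ht)).differentiableAt.differentiableWithinAt
    · intro t ht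
      rw [interior_Icc] at ht
      rw [(hg t (Ioo_subset_Icc_self ht)).deriv]
      exact hpos t ht
  exact hmono (left_mem_Icc.2 hxy) (right_mem_Icc.2 hxy) hxy

/-- The numerical endpoint: `log 0.32 ≥ −1.1424 = −(0.68 + 0.68²)`, certified from the
exponential series `∑_{i<6} 1.1424ⁱ / i! ≤ exp 1.1424`. [cite: BoydVandenberghe2004, §9.6.3 p. 503] -/
private theorem neg_le_log_at_endpoint : -(1.1424 : ℝ) ≤ Real.log 0.32 := by
  have hsum := Real.sum_le_exp_of_nonneg (show (0 : ℝ) ≤ 1.1424 by norm_num) 6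
  have hs : (3.13 : ℝ) ≤ ∑ i ∈ Finset.range 6, (1.1424 : ℝ) ^ i / (Nat.factorial i : ℝ) := by
    norm_num [Finset.sum_range_succ, Nat.factorial]
  have hexp : (3.13 : ℝ) ≤ Real.exp 1.1424 := le_trans hs hsum
  rw [Real.le_log_iff_exp_le (by norm_num), Real.exp_neg,
    inv_le_comm₀ (Real.exp_pos _) (by norm_num)]
  have : ((0.32 : ℝ))⁻¹ = 3.125 := by norm_num
  rw [this]
  linarith

/-- "`−(λ + log (1 − λ)) ≤ λ²` for `λ ≤ 0.68`": the function `log(1 − λ) + λ + λ²` has derivative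
`λ(1 − 2λ)/(1 − λ)`, so it increases on `[0, 1/2]` from `0` and decreases on `[1/2, 0.68]` to
`log 0.32 + 1.1424 ≥ 0`. [cite: BoydVandenberghe2004, §9.6.3 p. 503] -/
theorem neg_add_log_one_sub_le_sq {lam : ℝ} (h0 : 0 ≤ lam) (h1 : lam ≤ 0.68) :
    -(lam + Real.log (1 - lam)) ≤ lam ^ 2 := by
  let H : ℝ → ℝ := fun l => Real.log (1 - l) + l + l ^ 2
  have hderiv : ∀ l : ℝ, l < 1 → HasDerivAt H (l * (1 - 2 * l) / (1 - l)) l := by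
    intro l hl
    have hne : 1 - l ≠ 0 := by linarith
    have h1 : HasDerivAt (fun l : ℝ => 1 - l) (-1) l := by
      simpa using (hasDerivAt_id l).const_sub (1 : ℝ)
    have hlog := h1.log hne
    have hsq : HasDerivAt (fun l : ℝ => l ^ 2) (2 * l) l := by
      simpa using hasDerivAt_pow 2 l
    have hsum := (hlog.add (hasDerivAt_id l)).add hsq
    refine hsum.congr_deriv ?_
    field_simp
    ring
  suffices hH : 0 ≤ H lam by
    simp only [H] at hH
    linarith
  rcases le_total lam (1 / 2) with hle | hge
  · -- increasing on `[0, lam] ⊆ [0, 1/2]`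
    have h00 : H 0 = 0 := by simp [H]
    have hmono := le_of_hasDerivAt_nonneg (g := H) (g' := fun l => l * (1 - 2 * l) / (1 - l)) h0
      (fun t ht => hderiv t (by linarith [ht.2]))
      (fun t ht => by
        have h2 : 0 ≤ 1 - 2 * t := by linarith [ht.2]
        exact div_nonneg (mul_nonneg ht.1.le h2) (by linarith [ht.2]))
    linarith
  · -- decreasing on `[1/2, 0.68]`: compare with the endpoint
    have hend : 0 ≤ H 0.68 := by
      have := neg_le_log_at_endpoint
      show 0 ≤ Real.log (1 - 0.68) + 0.68 + 0.68 ^ 2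
      norm_num at this ⊢
      linarith
    -- `-H` increases on `[lam, 0.68]`
    have hneg : ∀ t ∈ Icc lam 0.68, HasDerivAt (fun l => -H l) (-(t * (1 - 2 * t) / (1 - t))) t :=
      fun t ht => (hderiv t (by linarith [ht.2])).neg
    have := le_of_hasDerivAt_nonneg (g := fun l => -H l) h1 hneg (fun t ht => by
      have ht1 : 1 / 2 ≤ t := le_trans hge ht.1.le
      have h2 : 1 - 2 * t ≤ 0 := by linarith
      have h3 : 0 < 1 - t := by linarith [ht.2]
      have : t * (1 - 2 * t) / (1 - t) ≤ 0 :=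
        div_nonpos_of_nonpos_of_nonneg (mul_nonpos_of_nonneg_of_nonpos (by linarith) h2) h3.le
      linarith)
    have hanti : -H lam ≤ -H 0.68 := this
    linarith

/-- "The second inequality follows from the fact that `−x + log(1 + x) + x²/(2(1 + x)) ≤ 0` for
`x ≥ 0`" (derivative `−x²/(2(1 + x)²) ≤ 0`). [cite: BoydVandenberghe2004, §9.6.4 p. 504] -/
theorem neg_add_log_add_sq_div_le {x : ℝ} (hx : 0 ≤ x) :
    -x + Real.log (1 + x) + x ^ 2 / (2 * (1 + x)) ≤ 0 := by
  let φ : ℝ → ℝ := fun x => -x + Real.log (1 + x) + x ^ 2 / (2 * (1 + x))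
  have hderiv : ∀ y : ℝ, 0 ≤ y → HasDerivAt φ (-(y ^ 2 / (2 * (1 + y) ^ 2))) y := by
    intro y hy
    have hne : 1 + y ≠ 0 := by linarith
    have hne2 : 2 * (1 + y) ≠ 0 := by positivity
    have h1 : HasDerivAt (fun y : ℝ => 1 + y) 1 y := by
      simpa using (hasDerivAt_id y).const_add 1
    have hlog := h1.log hne
    have hnum : HasDerivAt (fun y : ℝ => y ^ 2) (2 * y) y := by
      simpa using hasDerivAt_pow 2 y
    have hden : HasDerivAt (fun y : ℝ => 2 * (1 + y)) 2 y := by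
      simpa using h1.const_mul 2
    have hquot := hnum.div hden hne2
    have hall := ((hasDerivAt_id y).neg.add hlog).add hquot
    refine hall.congr_deriv ?_
    field_simp
    ring
  have h00 : φ 0 = 0 := by simp [φ]
  have hneg : ∀ t ∈ Icc 0 x, HasDerivAt (fun y => -φ y) (t ^ 2 / (2 * (1 + t) ^ 2)) t :=
    fun t ht => ((hderiv t ht.1).neg).congr_deriv (neg_neg _)
  have := le_of_hasDerivAt_nonneg (g := fun y => -φ y) hx hneg (fun t ht => by positivity)
  have hφ0 : -φ 0 = 0 := by rw [h00, neg_zero]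
  simp only [hφ0] at this
  simp only [φ] at this
  linarith

/-! ## Integrated bounds to the right of the base point -/

namespace SelfConcordantWith

variable {s : Set ℝ} {f f₁ f₂ f₃ : ℝ → ℝ} {x y : ℝ}

/-- (9.47): integrating the lower bound of (9.46) once — for `x ≤ y`, `[x, y] ⊆ s`, `f'' > 0`
on `[x, y]`: `f'(y) ≥ f'(x) + f''(x)^{1/2} − f''(x)^{1/2} / (1 + (y − x) f''(x)^{1/2})`.
[cite: BoydVandenberghe2004, §9.6.3 (9.47)] -/
theorem deriv_lower_bound (h : SelfConcordantWith s f f₁ f₂ f₃) (hxy : x ≤ y)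
    (hI : Icc x y ⊆ s) (hpos : ∀ τ ∈ Icc x y, 0 < f₂ τ) :
    f₁ x + Real.sqrt (f₂ x) - Real.sqrt (f₂ x) / (1 + (y - x) * Real.sqrt (f₂ x)) ≤ f₁ y := by
  set r := Real.sqrt (f₂ x) with hr
  have hr0 : 0 ≤ r := Real.sqrt_nonneg _
  have hrr : r * r = f₂ x := Real.mul_self_sqrt (h.nonneg x (hI (left_mem_Icc.2 hxy)))
  have hden : ∀ t, x ≤ t → 0 < 1 + (t - x) * r := fun t ht => by
    have := mul_nonneg (sub_nonneg.2 ht) hr0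
    linarith
  -- g t = f₁ t + r (1 + (t - x) r)⁻¹ - (f₁ x + r), g x = 0, g' = f₂ t - f₂ x / (1 + (t - x) r)²
  have hg : ∀ t ∈ Icc x y, HasDerivAt (fun t => f₁ t + r * (1 + (t - x) * r)⁻¹ - (f₁ x + r))
      (f₂ t - f₂ x / (1 + (t - x) * r) ^ 2) t := by
    intro t ht
    have h2 := h.hasDerivAt₂ t (hI ht)
    have hlin : HasDerivAt (fun t : ℝ => 1 + (t - x) * r) r t := by
      simpa using (((hasDerivAt_id t).sub_const x).mul_const r).const_add 1
    have hinv := (hlin.inv (hden t ht.1).ne').const_mul r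
    refine ((h2.add hinv).sub_const (f₁ x + r)).congr_deriv ?_
    rw [← hrr]
    field_simp
    ring
  have hmain := le_of_hasDerivAt_nonneg hxy hg (fun t ht => by
    have hsub : Icc x t ⊆ Icc x y := Icc_subset_Icc_right ht.2.le
    have := h.deriv2_lower_bound ht.1.le (hsub.trans hI) (fun τ hτ => hpos τ (hsub hτ))
    linarith)
  have hx1 : (1 + (x - x) * r)⁻¹ = 1 := by simp
  simp only [hx1, mul_one] at hmain
  rw [div_eq_mul_inv]
  linarith

/-- (9.48): integrating again — for `x ≤ y`, `[x, y] ⊆ s`, `f'' > 0` on `[x, y]`: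
`f(y) ≥ f(x) + (y − x) f'(x) + (y − x) f''(x)^{1/2} − log (1 + (y − x) f''(x)^{1/2})`.
[cite: BoydVandenberghe2004, §9.6.3 (9.48)] -/
theorem lower_bound (h : SelfConcordantWith s f f₁ f₂ f₃) (hxy : x ≤ y)
    (hI : Icc x y ⊆ s) (hpos : ∀ τ ∈ Icc x y, 0 < f₂ τ) :
    f x + (y - x) * f₁ x + (y - x) * Real.sqrt (f₂ x) - Real.log (1 + (y - x) * Real.sqrt (f₂ x))
      ≤ f y := by
  set r := Real.sqrt (f₂ x) with hr
  have hr0 : 0 ≤ r := Real.sqrt_nonneg _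
  have hden : ∀ t, x ≤ t → 0 < 1 + (t - x) * r := fun t ht => by
    have := mul_nonneg (sub_nonneg.2 ht) hr0
    linarith
  have hk : ∀ t ∈ Icc x y, HasDerivAt
      (fun t => f t - (t - x) * f₁ x - (t - x) * r + Real.log (1 + (t - x) * r) - f x)
      (f₁ t - (f₁ x + r - r / (1 + (t - x) * r))) t := by
    intro t ht
    have h1 := h.hasDerivAt₁ t (hI ht)
    have hl : HasDerivAt (fun t : ℝ => t - x) 1 t := by
      simpa using (hasDerivAt_id t).sub_const x
    have hlin : HasDerivAt (fun t : ℝ => 1 + (t - x) * r) r t := by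
      simpa using (((hasDerivAt_id t).sub_const x).mul_const r).const_add 1
    have hlog := hlin.log (hden t ht.1).ne'
    refine ((((h1.sub (hl.mul_const (f₁ x))).sub (hl.mul_const r)).add hlog).sub_const
      (f x)).congr_deriv ?_
    ring
  have hmain := le_of_hasDerivAt_nonneg hxy hk (fun t ht => by
    have hsub : Icc x t ⊆ Icc x y := Icc_subset_Icc_right ht.2.le
    have := h.deriv_lower_bound ht.1.le (hsub.trans hI) (fun τ hτ => hpos τ (hsub hτ))
    linarith)
  simp only [sub_self, zero_mul, add_zero, Real.log_one, sub_zero] at hmain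
  linarith

/-- Integrating the upper bound of (9.46) once — for `x ≤ y`, `[x, y] ⊆ s`, `f'' > 0` on
`[x, y]` and `(y − x) f''(x)^{1/2} < 1`:
`f'(y) ≤ f'(x) − f''(x)^{1/2} + f''(x)^{1/2} / (1 − (y − x) f''(x)^{1/2})`.
[cite: BoydVandenberghe2004, §9.6.4 (9.54)] -/
theorem deriv_upper_bound (h : SelfConcordantWith s f f₁ f₂ f₃) (hxy : x ≤ y)
    (hI : Icc x y ⊆ s) (hpos : ∀ τ ∈ Icc x y, 0 < f₂ τ)
    (hd : (y - x) * Real.sqrt (f₂ x) < 1) :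
    f₁ y ≤ f₁ x - Real.sqrt (f₂ x) + Real.sqrt (f₂ x) / (1 - (y - x) * Real.sqrt (f₂ x)) := by
  set r := Real.sqrt (f₂ x) with hr
  have hr0 : 0 ≤ r := Real.sqrt_nonneg _
  have hrr : r * r = f₂ x := Real.mul_self_sqrt (h.nonneg x (hI (left_mem_Icc.2 hxy)))
  have hden : ∀ t ∈ Icc x y, 0 < 1 - (t - x) * r := fun t ht => by
    have := mul_le_mul_of_nonneg_right (sub_le_sub_right ht.2 x) hr0
    linarith
  -- g t = (f₁ x - r) + r (1 - (t - x) r)⁻¹ - f₁ t, g x = 0, g' = f₂ x / (1 - (t - x) r)² - f₂ t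
  have hg : ∀ t ∈ Icc x y, HasDerivAt (fun t => f₁ x - r + r * (1 - (t - x) * r)⁻¹ - f₁ t)
      (f₂ x / (1 - (t - x) * r) ^ 2 - f₂ t) t := by
    intro t ht
    have h2 := h.hasDerivAt₂ t (hI ht)
    have hlin : HasDerivAt (fun t : ℝ => 1 - (t - x) * r) (-r) t := by
      simpa using (((hasDerivAt_id t).sub_const x).mul_const r).const_sub (1 : ℝ)
    have hinv := (hlin.inv (hden t ht).ne').const_mul r
    refine (((hinv.const_add (f₁ x - r))).sub h2).congr_deriv ?_
    rw [← hrr]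
    field_simp
  have hmain := le_of_hasDerivAt_nonneg hxy hg (fun t ht => by
    have htI : t ∈ Icc x y := Ioo_subset_Icc_self ht
    have hsub : Icc x t ⊆ Icc x y := Icc_subset_Icc_right ht.2.le
    have hdt : (t - x) * r < 1 := by
      have := mul_le_mul_of_nonneg_right (sub_le_sub_right ht.2.le x) hr0
      linarith
    have := h.deriv2_upper_bound ht.1.le (hsub.trans hI) (fun τ hτ => hpos τ (hsub hτ)) hdt
    linarith)
  have hx1 : (1 - (x - x) * r)⁻¹ = 1 := by simp
  simp only [hx1, mul_one] at hmain
  rw [div_eq_mul_inv]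
  linarith

/-- "If we integrate the upper bound in (9.46) twice, we obtain an upper bound": for `x ≤ y`,
`[x, y] ⊆ s`, `f'' > 0` on `[x, y]` and `(y − x) f''(x)^{1/2} < 1`,
`f(y) ≤ f(x) + (y − x) f'(x) − (y − x) f''(x)^{1/2} − log (1 − (y − x) f''(x)^{1/2})`.
[cite: BoydVandenberghe2004, §9.6.4 (9.54)] -/
theorem upper_bound (h : SelfConcordantWith s f f₁ f₂ f₃) (hxy : x ≤ y)
    (hI : Icc x y ⊆ s) (hpos : ∀ τ ∈ Icc x y, 0 < f₂ τ)
    (hd : (y - x) * Real.sqrt (f₂ x) < 1) :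
    f y ≤ f x + (y - x) * f₁ x - (y - x) * Real.sqrt (f₂ x)
      - Real.log (1 - (y - x) * Real.sqrt (f₂ x)) := by
  set r := Real.sqrt (f₂ x) with hr
  have hr0 : 0 ≤ r := Real.sqrt_nonneg _
  have hden : ∀ t ∈ Icc x y, 0 < 1 - (t - x) * r := fun t ht => by
    have := mul_le_mul_of_nonneg_right (sub_le_sub_right ht.2 x) hr0
    linarith
  have hk : ∀ t ∈ Icc x y, HasDerivAt
      (fun t => f x + (t - x) * f₁ x - (t - x) * r - Real.log (1 - (t - x) * r) - f t)
      (f₁ x - r + r / (1 - (t - x) * r) - f₁ t) t := by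
    intro t ht
    have h1 := h.hasDerivAt₁ t (hI ht)
    have hl : HasDerivAt (fun t : ℝ => t - x) 1 t := by
      simpa using (hasDerivAt_id t).sub_const x
    have hlin : HasDerivAt (fun t : ℝ => 1 - (t - x) * r) (-r) t := by
      simpa using (((hasDerivAt_id t).sub_const x).mul_const r).const_sub (1 : ℝ)
    have hlog := hlin.log (hden t ht).ne'
    refine (((((hl.mul_const (f₁ x)).const_add (f x)).sub (hl.mul_const r)).sub hlog).sub
      h1).congr_deriv ?_
    ring
  have hmain := le_of_hasDerivAt_nonneg hxy hk (fun t ht => by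
    have hsub : Icc x t ⊆ Icc x y := Icc_subset_Icc_right ht.2.le
    have hdt : (t - x) * r < 1 := by
      have := mul_le_mul_of_nonneg_right (sub_le_sub_right ht.2.le x) hr0
      linarith
    have := h.deriv_upper_bound ht.1.le (hsub.trans hI) (fun τ hτ => hpos τ (hsub hτ)) hdt
    linarith)
  simp only [sub_self, zero_mul, add_zero, sub_zero, Real.log_one] at hmain
  linarith

/-! ## The Newton decrement and two-sided bounds -/

/-- The Newton decrement in one variable, `λ(x) = |f'(x)| / f''(x)^{1/2}`
(`= (∇f(x)ᵀ ∇²f(x)⁻¹ ∇f(x))^{1/2}` for `n = 1`). [cite: BoydVandenberghe2004, §9.5.1 (9.29)] -/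
noncomputable def newtonDecrement (f₁ f₂ : ℝ → ℝ) (x : ℝ) : ℝ := |f₁ x| / Real.sqrt (f₂ x)

/-- [cite: BoydVandenberghe2004, §9.5.1 (9.29)] -/
theorem newtonDecrement_nonneg (f₁ f₂ : ℝ → ℝ) (x : ℝ) : 0 ≤ newtonDecrement f₁ f₂ x :=
  div_nonneg (abs_nonneg _) (Real.sqrt_nonneg _)

/-- `λ(x)² = f'(x)² / f''(x)` (for `f''(x) ≥ 0`), i.e. `λ² = ∇fᵀ (∇²f)⁻¹ ∇f` in one variable.
[cite: BoydVandenberghe2004, §9.5.1 (9.29)] -/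
theorem newtonDecrement_sq {f₁ f₂ : ℝ → ℝ} {x : ℝ} (h2 : 0 ≤ f₂ x) :
    newtonDecrement f₁ f₂ x ^ 2 = f₁ x ^ 2 / f₂ x := by
  rw [newtonDecrement, div_pow, sq_abs, Real.sq_sqrt h2]

/-- One-sided form of (9.49): for `x ≤ y` with `[x, y] ⊆ s`, `f'' > 0` on `[x, y]` and
`λ(x) < 1`, `f(y) ≥ f(x) + λ(x) + log (1 − λ(x))`. [cite: BoydVandenberghe2004, §9.6.3 (9.49)] -/
theorem newton_lower_bound_right (h : SelfConcordantWith s f f₁ f₂ f₃) (hxy : x ≤ y)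
    (hI : Icc x y ⊆ s) (hpos : ∀ τ ∈ Icc x y, 0 < f₂ τ)
    (hlam : newtonDecrement f₁ f₂ x < 1) :
    f x + (newtonDecrement f₁ f₂ x + Real.log (1 - newtonDecrement f₁ f₂ x)) ≤ f y := by
  have hb := h.lower_bound hxy hI hpos
  set r := Real.sqrt (f₂ x) with hr
  have hc : 0 < f₂ x := hpos x (left_mem_Icc.2 hxy)
  have hrpos : 0 < r := Real.sqrt_pos.2 hc
  set lam := newtonDecrement f₁ f₂ x with hlam_def
  have hlam0 : 0 ≤ lam := newtonDecrement_nonneg f₁ f₂ x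
  -- u = (y - x) r ≥ 0 and (y - x) f₁ x ≥ -lam * u
  set u := (y - x) * r with hu
  have hu0 : 0 ≤ u := mul_nonneg (sub_nonneg.2 hxy) hrpos.le
  have hkey : -(lam * u) ≤ (y - x) * f₁ x := by
    have h1 : lam * u = |f₁ x| * (y - x) := by
      have hl : lam = |f₁ x| / r := rfl
      rw [hl, hu]
      field_simp
    rw [h1]
    have := neg_abs_le (f₁ x)
    nlinarith [sub_nonneg.2 hxy, abs_nonneg (f₁ x)]
  have hmin := add_log_le_sub_mul_sub_log hlam hu0
  linarith

/-- (9.49) in one variable, both sides: if `s` is an interval (convex), `f'' > 0` on `s`,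
`x, y ∈ s` and `λ(x) < 1`, then `f(y) ≥ f(x) + λ(x) + log (1 − λ(x))` — "this inequality holds
for any descent direction" (here: `y` on either side of `x`, via the reflection `t ↦ −t`).
[cite: BoydVandenberghe2004, §9.6.3 (9.49)] -/
theorem newton_lower_bound (h : SelfConcordantWith s f f₁ f₂ f₃) (hs : Convex ℝ s)
    (hpos : ∀ τ ∈ s, 0 < f₂ τ) (hx : x ∈ s) (hy : y ∈ s)
    (hlam : newtonDecrement f₁ f₂ x < 1) :
    f x + (newtonDecrement f₁ f₂ x + Real.log (1 - newtonDecrement f₁ f₂ x)) ≤ f y := by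
  have hsI : ∀ {a b : ℝ}, a ∈ s → b ∈ s → Icc a b ⊆ s := fun ha hb =>
    (convex_iff_ordConnected.mp hs).out ha hb
  rcases le_total x y with hxy | hyx
  · exact h.newton_lower_bound_right hxy (hsI hx hy) (fun τ hτ => hpos τ (hsI hx hy hτ)) hlam
  · -- reflect: g t = f (-t)
    have h' := h.comp_affine (-1) 0
    have hI' : Icc (-x) (-y) ⊆ (fun t : ℝ => -1 * t + 0) ⁻¹' s := by
      intro t ht
      simp only [mem_preimage, neg_one_mul, add_zero]
      exact hsI hy hx ⟨by linarith [ht.2], by linarith [ht.1]⟩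
    have hpos' : ∀ τ ∈ Icc (-x) (-y), 0 < (-1 : ℝ) ^ 2 * f₂ (-1 * τ + 0) := by
      intro τ hτ
      have : -1 * τ + 0 ∈ s := hI' hτ
      simpa using hpos _ this
    have hlam' : newtonDecrement (fun t => -1 * f₁ (-1 * t + 0)) (fun t => (-1 : ℝ) ^ 2 * f₂ (-1 * t + 0))
        (-x) = newtonDecrement f₁ f₂ x := by
      simp [newtonDecrement, abs_neg]
    have := h'.newton_lower_bound_right (x := -x) (y := -y) (by linarith) hI' hpos'
      (by rw [hlam']; exact hlam)
    rw [hlam'] at this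
    simpa using this

/-- (9.50): `p⋆ ≥ f(x) − λ(x)²`, valid for `λ(x) ≤ 0.68` — here: `f(y) ≥ f(x) − λ(x)²` for every
`y` in the interval. [cite: BoydVandenberghe2004, §9.6.3 (9.50)] -/
theorem sub_sq_le (h : SelfConcordantWith s f f₁ f₂ f₃) (hs : Convex ℝ s)
    (hpos : ∀ τ ∈ s, 0 < f₂ τ) (hx : x ∈ s) (hy : y ∈ s)
    (hlam : newtonDecrement f₁ f₂ x ≤ 0.68) :
    f x - newtonDecrement f₁ f₂ x ^ 2 ≤ f y := by
  have h1 : newtonDecrement f₁ f₂ x < 1 := lt_of_le_of_lt hlam (by norm_num)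
  have hb := h.newton_lower_bound hs hpos hx hy h1
  have hsq := neg_add_log_one_sub_le_sq (newtonDecrement_nonneg f₁ f₂ x) hlam
  linarith

/-- The stopping criterion: "`λ(x)² ≤ ε` (where `ε < 0.68²`) guarantees that on exit
`f(x) − p⋆ ≤ ε`" — here: `f(x) − f(y) ≤ ε` for every `y` in the interval.
[cite: BoydVandenberghe2004, §9.6.3 p. 503] -/
theorem sub_le_of_sq_le (h : SelfConcordantWith s f f₁ f₂ f₃) (hs : Convex ℝ s)
    (hpos : ∀ τ ∈ s, 0 < f₂ τ) (hx : x ∈ s) (hy : y ∈ s) {ε : ℝ}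
    (hε : ε ≤ 0.68 ^ 2) (hlam : newtonDecrement f₁ f₂ x ^ 2 ≤ ε) :
    f x - f y ≤ ε := by
  have hl : newtonDecrement f₁ f₂ x ≤ 0.68 := by
    have := newtonDecrement_nonneg f₁ f₂ x
    nlinarith
  have := h.sub_sq_le hs hpos hx hy hl
  linarith

/-! ## The damped Newton step -/

/-- The damped Newton step of the first phase: with the Newton step `Δ = −f'(x)/f''(x)`,
`λ = λ(x)` and `t̂ = 1/(1 + λ)`, if the segment from `x` to `x + t̂Δ` lies in `s` (with `f'' > 0`
on it), then `f(x + t̂Δ) ≤ f(x) − λ + log(1 + λ)` — (9.54) at `t̂`, using `f̃'(0) = −λ²`,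
`f̃''(0) = λ²`. [cite: BoydVandenberghe2004, §9.6.4 (9.54)] -/
theorem damped_newton_step_le' (h : SelfConcordantWith s f f₁ f₂ f₃) (hs : Convex ℝ s)
    (hpos : ∀ τ ∈ s, 0 < f₂ τ) (hx : x ∈ s)
    (hy : x - (1 / (1 + newtonDecrement f₁ f₂ x)) * (f₁ x / f₂ x) ∈ s) :
    f (x - (1 / (1 + newtonDecrement f₁ f₂ x)) * (f₁ x / f₂ x))
      ≤ f x - newtonDecrement f₁ f₂ x + Real.log (1 + newtonDecrement f₁ f₂ x) := by
  have hsI : ∀ {a b : ℝ}, a ∈ s → b ∈ s → Icc a b ⊆ s := fun ha hb =>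
    (convex_iff_ordConnected.mp hs).out ha hb
  set lam := newtonDecrement f₁ f₂ x with hlam_def
  have hlam0 : 0 ≤ lam := newtonDecrement_nonneg f₁ f₂ x
  have hc : 0 < f₂ x := hpos x hx
  set r := Real.sqrt (f₂ x) with hr
  have hrpos : 0 < r := Real.sqrt_pos.2 hc
  have hrr : r * r = f₂ x := Real.mul_self_sqrt hc.le
  have hlam_eq : lam = |f₁ x| / r := rfl
  set th := 1 / (1 + lam) with hth
  have hth0 : 0 < th := by positivity
  set y := x - th * (f₁ x / f₂ x) with hy_def
  -- the key identities: (y - x) f₁ x = -th lam², |y - x| r = th lam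
  have hprod : (y - x) * f₁ x = -(th * lam ^ 2) := by
    rw [hy_def, hlam_eq, div_pow, sq_abs, ← hrr]
    field_simp
    ring
  have habs : |y - x| * r = th * lam := by
    rw [hy_def, hlam_eq]
    have : x - th * (f₁ x / f₂ x) - x = -(th * (f₁ x / f₂ x)) := by ring
    rw [this, abs_neg, abs_mul, abs_of_pos hth0, abs_div, abs_of_pos hc, ← hrr]
    field_simp
  have hd : th * lam < 1 := by
    rw [hth, div_mul_eq_mul_div, one_mul, div_lt_one (by positivity)]
    linarith
  have hlog_id : 1 - th * lam = (1 + lam)⁻¹ := by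
    rw [hth]
    field_simp
    ring
  rcases le_total x y with hxy | hyx
  · have hyx' : |y - x| = y - x := abs_of_nonneg (sub_nonneg.2 hxy)
    have hd' : (y - x) * r < 1 := by rw [← hyx', habs]; exact hd
    have hub := h.upper_bound hxy (hsI hx hy) (fun τ hτ => hpos τ (hsI hx hy hτ)) hd'
    rw [hprod, ← hyx', habs, hlog_id, Real.log_inv] at hub
    have : th * lam ^ 2 + th * lam = lam := by
      rw [hth]
      field_simp
      ring
    linarith
  · -- reflect
    have h' := h.comp_affine (-1) 0
    have hI' : Icc (-x) (-y) ⊆ (fun t : ℝ => -1 * t + 0) ⁻¹' s := by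
      intro t ht
      simp only [mem_preimage, neg_one_mul, add_zero]
      exact hsI hy hx ⟨by linarith [ht.2], by linarith [ht.1]⟩
    have hpos' : ∀ τ ∈ Icc (-x) (-y), 0 < (-1 : ℝ) ^ 2 * f₂ (-1 * τ + 0) := by
      intro τ hτ
      have : -1 * τ + 0 ∈ s := hI' hτ
      simpa using hpos _ this
    have hxy' : |y - x| = x - y := by rw [abs_sub_comm]; exact abs_of_nonneg (sub_nonneg.2 hyx)
    have hsqrt : Real.sqrt ((-1 : ℝ) ^ 2 * f₂ (-1 * -x + 0)) = r := by simp [hr]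
    have hd' : (-y - -x) * Real.sqrt ((-1 : ℝ) ^ 2 * f₂ (-1 * -x + 0)) < 1 := by
      rw [hsqrt, show -y - -x = x - y by ring, ← hxy', habs]; exact hd
    have hub := h'.upper_bound (x := -x) (y := -y) (by linarith) hI' hpos' hd'
    rw [hsqrt] at hub
    simp only [neg_one_mul, neg_neg, add_zero] at hub
    have e1 : (-y - -x) * -f₁ x = (y - x) * f₁ x := by ring
    have e2 : (-y - -x) * r = |y - x| * r := by rw [hxy']; ring
    rw [e1, hprod, e2, habs, hlog_id, Real.log_inv] at hub
    have : th * lam ^ 2 + th * lam = lam := by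
      rw [hth]
      field_simp
      ring
    linarith

/-- … hence the point `t̂ = 1/(1 + λ(x))` "satisfies the exit condition of the line search":
`f(x + t̂Δ) ≤ f(x) − λ(x)²/(2(1 + λ(x))) = f(x) − ½ λ(x)² t̂` (so for every `α ≤ 1/2`,
`f(x + t̂Δ) ≤ f(x) − α λ(x)² t̂`). [cite: BoydVandenberghe2004, §9.6.4 p. 504] -/
theorem damped_newton_step_le (h : SelfConcordantWith s f f₁ f₂ f₃) (hs : Convex ℝ s)
    (hpos : ∀ τ ∈ s, 0 < f₂ τ) (hx : x ∈ s)
    (hy : x - (1 / (1 + newtonDecrement f₁ f₂ x)) * (f₁ x / f₂ x) ∈ s) :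
    f (x - (1 / (1 + newtonDecrement f₁ f₂ x)) * (f₁ x / f₂ x))
      ≤ f x - newtonDecrement f₁ f₂ x ^ 2 / (2 * (1 + newtonDecrement f₁ f₂ x)) := by
  have h1 := h.damped_newton_step_le' hs hpos hx hy
  have h2 := neg_add_log_add_sq_div_le (newtonDecrement_nonneg f₁ f₂ x)
  linarith

end SelfConcordantWith

end Literature.Analysis.Convex.SelfConcordant
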